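import Summits.QuantumFields.YangMills.Theorems.UnitScaleTiltProp7TubeStrLineIterRefMean
import Summits.QuantumFields.YangMills.Theorems.UnitScaleTiltProp7TubeComparisonRowFlat
import Summits.QuantumFields.YangMills.Theorems.UnitScaleTiltProp7SkewSplitOpNormRow
import HarnessLib

/-!
# Route `UnitScaleTilt`, crux «MinimiserStabilityRegPr» (stmt-QuantumFields-19200, stub EX), positivity block, pen (b1)-(iv) «TOWER-vs-CORNER TRANSPORTS» —
# FILE 2b: ★★★ THE (iv) ROW — `Σ_c ‖T^{str}_W A(c) − ℓ^d·Ad_{Φ(c)} S_{K−n}A(c)‖² ≤ 10⁹L⁴·ε₀²·ℓ^{d+2}·Σ_b‖A b‖²`, `Φ(c) = axialT W♭ (corner c) (centre c)`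
# («= the (R-C) remainder of the 20520 [RP]-curved lane, typed once here; 20520 consumers cite by name»)

Cell `ym3-torus` (rung R3 — YM₃ on T³; NOT d = 4, NOT the Clay problem).  Width seat `ym-routeR-w4` g25 (pen named by w7-19200 g10 2026-08-29 21:13:16Z, ★★OWNER WORD 52; the framed row
accepted 21:23:50Z; docks on the (b) holder's assembly door ✓`Prop7SkewFrobRowAssembly.skewFrobRow_of_rows` as `hR1` after the op→Frobenius line).  THEOREMS ONLY (0 `def`, 0 `sorry`);
`--supports stmt-QuantumFields-19200 --as helper`; count-neutral.

THE POINT.  The corner tree-word tube sum `T^{str}_W A(c)` of ✓`Prop7TransverseRowOfQTwSTubeComparison` (the (T) engine's averaging functional) and the top-level pure `LINE` iterate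
`S_{K−n}(c)` of ✓`Prop7TrueLinIterDefect` sum the SAME fine bonds of the double block `B^k(c₋) ∪ B^k(c₊)` (the one-stroke identity ✓`B5Eq118OneStroke.bondAvgIter_eq_blockSum`) with
DIFFERENT transports: one-shot corner combs + runs vs nested centre stairs + runs along the (0.4) tower.  In the corner axial gauge `u` both transports are `O(L²ε₀)`-close to the
references (FILE 1 ✓`Prop7TubeTransportCloseness`; FILE 2a ✓`Prop7TubeStrLineIterRefMean.lineIter_sub_refMean_le`): the corner comb IS `u` (✓`rel_corner_fibreSite`), the run is
`1800Lε₀`-close, the nested transports `10800L²ε₀`-close; framing `S` by `Φ(c) = u(centre)` aligns the anchors (WITHOUT the frame the row is false at curved members — pure-gauge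
witness, this seat's bus note 21:18:47Z).  Cauchy–Schwarz over the `ℓ^{d+1}` tube terms and the exact multiplicity `Σ_cΣ_{(r,t)} = ℓ·Σ_b` give the row with `(12000L²)²ε₀² ≤ 10⁹L⁴ε₀²`.
HONEST SCOPE.  Bookkeeping + [Balaban1985Averaging] Prop. 4 ∕ [Balaban1985RegularSpaces] Lemma 1 AS LANDED in the tree; no estimate of print beyond those; `hQcmp` (the assembly, w7),
the γ-row, the 10 print rows, `hThm2S`, EX `stub_existenceMinimalOrbit` and the crux `MinimiserStabilityRegPr` are NOT proved here.
References: T. Bałaban, CMP **98** (1985) 17–51 [Balaban1985Averaging] ((8)–(11) pp.18–19, (58) p.27, Prop. 4 (134)–(135) p.38); CMP **95** (1984) 17–40 [Balaban1984PropagatorsI]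
((1.18) p.20); CMP **99** (1985) 75–102 [Balaban1985RegularSpaces] (Lemma 1 (1.25) p.79); CMP **99** (1985) 389–434 [Balaban1985BackgroundPropagators] (Thm 3.11 p.416, (3.118)–(3.122)).
-/

set_option autoImplicit false

noncomputable section

open scoped BigOperators Matrix.Norms.L2Operator

namespace Summit.QuantumFields.YangMills.Theorems.Prop7TubeStrSubStairLineIter

open Literature.MathematicalPhysics.QuantumFieldTheory.Balaban1983to89
open Literature.MathematicalPhysics.QuantumFieldTheory.Balaban1983to89.T3ContinuumYM3Torus
open Finset T4Continuum BlockAveraging AveragingRT ExpMeanLog BlockAveragingEMLLinearised BlockAveragingEMLLinearisedBackground BlockAveragingEMLProp2 LatticeFieldCalculus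
open B1RG242Torus
open B5Eq118OneStroke (iterBlockOf iterBlock mem_iterBlock iterBlockOf_zero bondAvgIter_eq_blockSum)
open B15DeterminingSets (embIter)
open B7Prop1Explicit (U1 mem_U1 treeWord)
open B7Eq78Linearization (conjR conjR_apply conjR_sub conjR_smul conjR_smul_real)
open B8Ineq132 (norm_conjR norm_conjR_le conjR_conjR one_conjR conjR_sum)
open B10Eq27TorusAxialLog (holT axialT axialT_self gaugeActT gaugeActT_apply unitsField toUField holT_eq_holAt)
open T3PrintedRegularMinimiser (RegPr)
open T3RegularMinimiser (regThreshold regThreshold_pos)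
open T3SectALandauChart (eta eta_pos bgUnits)
open Summit.QuantumFields.YangMills.Theorems.Prop8Chart (emlIterU emlIterU_zero)
open Summit.QuantumFields.YangMills.Theorems.Prop7SymAvgTwSym (holT_mem_U1 unitsField_toUField_mem_U1' pow_mul_eta_eq_one pow_mul_eta_le_one)
open Summit.QuantumFields.YangMills.Theorems.Prop7SymAvgGLSmallOfRegPr (bgUnits_eq)
open Summit.QuantumFields.YangMills.Theorems.Prop7NestedMeanTowerCloseness (rel_corner_fibreSite)
open Summit.QuantumFields.YangMills.Theorems.Prop7TubeTransportCloseness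
open Summit.QuantumFields.YangMills.Theorems.Prop7TubeStrLineIterRefMean
open Summit.QuantumFields.YangMills.Theorems.Prop7TubeComparisonRowFlat (iterate_shift_eq_runSite)
open Summit.QuantumFields.YangMills.Theorems.Prop7CompetitorEnergyMember (real_smul_eq_coe_smul)
open Summit.QuantumFields.YangMills.Theorems.Prop7FlatCoercivity (sum_iterShift)
open B10StarCount (sum_pbond)

/-! ## §1 Tube bookkeeping: the exact multiplicity and Cauchy–Schwarz -/

section Tubes

variable {P : Params} {k : ℕ}

/-- **EXACT MULTIPLICITY OF THE CORNER TUBES**: `Σ_{c : k-bonds} Σ_r Σ_{t<L^k} g(fibreSite 0 k c₋ r + te_{μ_c}, μ_c) = L^k·Σ_b g(b)` — each fine bond lies in the tubes with total multiplicity `L^k`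
(the blocks of order `k` partition the sites; translations are bijections). [cite: Balaban1984PropagatorsI, (1.18) p.20] -/
theorem sum_tube_eq (hk : k ≤ P.m + P.K) (g : PBond P 0 → ℝ) :
    ∑ c : PBond P k, ∑ r : Fin P.d → Fin (P.L ^ k), ∑ t ∈ Finset.range (P.L ^ k),
        g ⟨(fun z : Site P 0 => z.shift c.dir)^[t] (Site.fibreSite 0 k c.src r), c.dir⟩
      = (P.L : ℝ) ^ k * ∑ b : PBond P 0, g b := by
  rw [sum_pbond]
  have hfib : ∀ (μ : Fin P.d) (t : ℕ), ∑ y : Site P k, ∑ r : Fin P.d → Fin (P.L ^ k), g ⟨(fun z : Site P 0 => z.shift μ)^[t] (Site.fibreSite 0 k y r), μ⟩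
      = ∑ x : Site P 0, g ⟨x, μ⟩ := by
    intro μ t
    have h1 : ∀ y : Site P k, ∑ r : Fin P.d → Fin (P.L ^ k), g ⟨(fun z : Site P 0 => z.shift μ)^[t] (Site.fibreSite 0 k y r), μ⟩
        = ∑ x ∈ iterBlock k y, g ⟨(fun z : Site P 0 => z.shift μ)^[t] x, μ⟩ :=
      fun y => (B5Eq117TorusCarriers.sum_iterBlock_eq hk y (fun x => g ⟨(fun z : Site P 0 => z.shift μ)^[t] x, μ⟩)).symm
    simp only [h1]
    rw [← sum_iterShift μ (fun x : Site P 0 => g ⟨x, μ⟩) t]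
    unfold iterBlock
    exact Finset.sum_fiberwise Finset.univ (iterBlockOf k) (fun x => g ⟨(fun z : Site P 0 => z.shift μ)^[t] x, μ⟩)
  set G : Fin P.d → ℕ → Site P k → (Fin P.d → Fin (P.L ^ k)) → ℝ :=
    fun μ t y r => g ⟨(fun z : Site P 0 => z.shift μ)^[t] (Site.fibreSite 0 k y r), μ⟩ with hG
  show ∑ y : Site P k, ∑ μ : Fin P.d, ∑ r : Fin P.d → Fin (P.L ^ k), ∑ t ∈ Finset.range (P.L ^ k), G μ t y r = _
  calc ∑ y : Site P k, ∑ μ : Fin P.d, ∑ r : Fin P.d → Fin (P.L ^ k), ∑ t ∈ Finset.range (P.L ^ k), G μ t y r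
      = ∑ μ : Fin P.d, ∑ t ∈ Finset.range (P.L ^ k), ∑ y : Site P k, ∑ r : Fin P.d → Fin (P.L ^ k), G μ t y r := by
        rw [Finset.sum_comm]
        refine Finset.sum_congr rfl fun μ _ => ?_
        calc ∑ y : Site P k, ∑ r : Fin P.d → Fin (P.L ^ k), ∑ t ∈ Finset.range (P.L ^ k), G μ t y r
            = ∑ y : Site P k, ∑ t ∈ Finset.range (P.L ^ k), ∑ r : Fin P.d → Fin (P.L ^ k), G μ t y r :=
              Finset.sum_congr rfl fun y _ => Finset.sum_comm
          _ = ∑ t ∈ Finset.range (P.L ^ k), ∑ y : Site P k, ∑ r : Fin P.d → Fin (P.L ^ k), G μ t y r := Finset.sum_comm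
    _ = ∑ μ : Fin P.d, ∑ _t ∈ Finset.range (P.L ^ k), ∑ x : Site P 0, g ⟨x, μ⟩ := by simp only [hG, hfib]
    _ = (P.L : ℝ) ^ k * ∑ b : PBond P 0, g b := by
        rw [sum_pbond, Finset.sum_comm]
        simp only [Finset.sum_const, Finset.card_range, nsmul_eq_mul, Finset.mul_sum]
        push_cast
        exact Finset.sum_comm

/-- Cauchy–Schwarz over the `L^{dk}·L^k` tube terms: `(Σ_rΣ_{t<L^k} a)² ≤ (L^k)^d·L^k·Σ_rΣ_t a²`. [folklore] -/
theorem sq_sum_tube_le (a : (Fin P.d → Fin (P.L ^ k)) → ℕ → ℝ) :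
    (∑ r : Fin P.d → Fin (P.L ^ k), ∑ t ∈ Finset.range (P.L ^ k), a r t) ^ 2
      ≤ (((P.L : ℝ) ^ k) ^ P.d * (P.L : ℝ) ^ k) * ∑ r : Fin P.d → Fin (P.L ^ k), ∑ t ∈ Finset.range (P.L ^ k), a r t ^ 2 := by
  rw [← Finset.sum_product' Finset.univ (Finset.range (P.L ^ k)) a, ← Finset.sum_product' Finset.univ (Finset.range (P.L ^ k)) (fun r t => a r t ^ 2)]
  refine (sq_sum_le_card_mul_sum_sq (s := Finset.univ ×ˢ Finset.range (P.L ^ k)) (f := fun p => a p.1 p.2)).trans (le_of_eq ?_)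
  congr 1
  rw [Finset.card_product, Finset.card_univ, Fintype.card_fun, Fintype.card_fin, Fintype.card_fin, Finset.card_range]
  push_cast; ring

/-- **THE ONE-STROKE IDENTITY ON THE CORNER TUBES** ([Balaban1984PropagatorsI] (1.18) read backwards): the plain tube sum of a bond field over the block of order `k` and
the straight contours of length `L^k` is `(L^{d+1})^k • bondAvgIter k`. [cite: Balaban1984PropagatorsI, (1.18) p.20] -/
theorem sum_tube_eq_smul_bondAvgIter (hk : k ≤ P.m + P.K) {V : Type*} [AddCommGroup V] [Module ℝ V] (Z : VecField P 0 V) (c : PBond P k) :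
    ∑ r : Fin P.d → Fin (P.L ^ k), ∑ t ∈ Finset.range (P.L ^ k), Z ⟨(fun z : Site P 0 => z.shift c.dir)^[t] (Site.fibreSite 0 k c.src r), c.dir⟩
      = (((P.L : ℝ) ^ (P.d + 1)) ^ k) • bondAvgIter k Z c := by
  simp only [iterate_shift_eq_runSite]
  have hseg : ∀ r : Fin P.d → Fin (P.L ^ k), ∑ t ∈ Finset.range (P.L ^ k), Z ⟨runSite (Site.fibreSite 0 k c.src r) c.dir t, c.dir⟩
      = segSum Z (Site.fibreSite 0 k c.src r) c.dir (P.L ^ k) := fun r => rfl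
  simp only [hseg]
  -- re-index the offsets as the block of order `k` (`blockSiteK ≡ Site.fibreSite 0` definitionally)
  have hsum : ∑ r : Fin P.d → Fin (P.L ^ k), segSum Z (Site.fibreSite 0 k c.src r) c.dir (P.L ^ k) = ∑ x ∈ iterBlock k c.src, segSum Z x c.dir (P.L ^ k) :=
    (B5Eq117TorusCarriers.sum_iterBlock_eq hk c.src (fun x => segSum Z x c.dir (P.L ^ k))).symm
  rw [hsum, bondAvgIter_eq_blockSum k hk Z c, smul_smul, mul_inv_cancel₀ (by have := P.L_pos; positivity), one_smul]

end Tubes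

/-! ## §2 The corner transport of the tube functional is `3600Lε₀`-close to the corner axial gauge (per fine bond) -/

variable (F : T3Family) {n K : ℕ}

/-- `Φ(c) = axialT W♭ (corner c) (centre c)` is a unitary unit of `M₂(ℂ)` (the frame letter `hΦ` of the assembly door ✓`Prop7SkewFrobRowAssembly.skewFrobRow_of_rows`).
[cite: Balaban1985RegularSpaces, (1.1) p.76] -/
theorem axialT_bg_mem_unitaryUnits (W : GaugeField (F.P K) 0 (Matrix.specialUnitaryGroup (Fin 2) ℂ)) (q x : Site (F.P K) 0) :
    axialT (unitsField (toUField W)) q x ∈ B7Prop2Explicit.unitaryUnits (Matrix (Fin 2) (Fin 2) ℂ) := by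
  unfold axialT
  rw [← B10Eq27TorusAxialLog.hol_pull_zero]
  exact B7Prop2Explicit.hol_mem_of (V := B10Eq27TorusAxialLog.pull (unitsField (toUField W)) q)
    (fun _ _ => B10Eq27TorusAxialLog.unitsField_mem_unitaryUnits (toUField W) _) 0 _

/-- ★★ **TUBE TRANSPORT vs CORNER AXIAL GAUGE, PER FINE BOND.**  On `PlaqSmall (regThreshold F n K ε₀) W`, `10⁷L³ε₀ ≤ 1`: for the corner `x₀` of `B^{K−n}(y)`, an offset `r`,
`t ≤ L^{K−n}` and any `X ∈ M₂`: `‖Ad_{W♭(comb x₀→x_r)·W♭(run x_r→x_r+te_μ)} X − Ad_{u(x_r+te_μ)} X‖ ≤ 2·1800Lε₀·‖X‖`, `u = axialT W♭ x₀` — the comb IS `u(x_r)` (✓`rel_corner_fibreSite`),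
the run stays in the double block `B^{K−n}(y) ∪ B^{K−n}(y+e_μ)` (✓`iterBlockOf_runSite_fibreSite_or`, no wrap ✓`four_le_sitesPerDir_T3`) where the `u`-gauged field is `s₀`-close to `1`
(✓`norm_axialGauge_bond_sub_one_le_twoBlock_T3`), so FILE 1 ✓`norm_holT_tower_gauged_sub_one_le` at level `0` gives `‖u(x_r)·W♭(run)·u(end)⁻¹ − 1‖ ≤ t·30ℓ′s₀ ≤ 1800Lε₀·(L^{K−n}η) = 1800Lε₀`.
[cite: Balaban1985Averaging, Prop. 4 (134)-(135) p.38, (19)-(20) p.21; Balaban1985RegularSpaces, Lemma 1 (1.25) p.79] -/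
theorem norm_conjR_tubeTransport_sub_conjR_axial_le {ε₀ : ℝ} (hε₀ : 0 < ε₀) (hε7 : 10 ^ 7 * (F.L : ℝ) ^ 3 * ε₀ ≤ 1)
    (W : GaugeField (F.P K) 0 (Matrix.specialUnitaryGroup (Fin 2) ℂ)) (hW : PlaqSmall (regThreshold F n K ε₀) W)
    (y : Site (F.P K) (K - n)) (μ : Fin (F.P K).d) (r : Fin (F.P K).d → Fin ((F.P K).L ^ (K - n))) {t : ℕ} (ht : t ≤ (F.P K).L ^ (K - n)) (X : Matrix (Fin 2) (Fin 2) ℂ) :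
    ‖conjR (holT (bgUnits F K W) (Site.fibreSite 0 (K - n) y fun _ => (⟨0, pow_pos (F.P K).L_pos (K - n)⟩ : Fin ((F.P K).L ^ (K - n)))) (treeWord fun ν => ((r ν : ℕ) : ℤ))
          * holT (bgUnits F K W) (Site.fibreSite 0 (K - n) y r) (List.replicate t (μ, true))) X
        - conjR (axialT (bgUnits F K W) (Site.fibreSite 0 (K - n) y fun _ => (⟨0, pow_pos (F.P K).L_pos (K - n)⟩ : Fin ((F.P K).L ^ (K - n)))) ((fun z : Site (F.P K) 0 => z.shift μ)^[t] (Site.fibreSite 0 (K - n) y r))) X‖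
      ≤ 2 * (1800 * (F.L : ℝ) * ε₀) * ‖X‖ := by
  rw [iterate_shift_eq_runSite]
  have hk : K - n ≤ (F.P K).m + (F.P K).K := by show K - n ≤ F.m + K; omega
  have hLL : ((F.P K).L : ℝ) = F.L := rfl
  have hL3 : (3 : ℝ) ≤ F.L := by
    have h3 : 3 ≤ F.L := by obtain ⟨a, ha⟩ := F.hL.1; have := F.hL.2; omega
    exact_mod_cast h3
  have hη : 0 < eta F n K := eta_pos F n K
  set q₀ := (Site.fibreSite 0 (K - n) y fun _ => (⟨0, pow_pos (F.P K).L_pos (K - n)⟩ : Fin ((F.P K).L ^ (K - n)))) with hq₀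
  set u : Site (F.P K) 0 → (Matrix (Fin 2) (Fin 2) ℂ)ˣ := axialT (bgUnits F K W) q₀ with hu
  set xr := Site.fibreSite 0 (K - n) y r with hxr
  set s₀ : ℝ := 2 * ((3 : ℝ) * (2 * (F.L : ℝ) ^ (K - n) - 1)) * regThreshold F n K ε₀ with hs₀def
  have hs₀ : 0 ≤ s₀ := by
    have := (regThreshold_pos F (n := n) (K := K) hε₀).le
    have hL1 : (1 : ℝ) ≤ (F.L : ℝ) ^ (K - n) := one_le_pow₀ (by linarith)
    have : (0 : ℝ) ≤ 2 * (F.L : ℝ) ^ (K - n) - 1 := by linarith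
    positivity
  obtain ⟨hbud, hσle⟩ := budget_twoBlock_T3 F (n := n) (K := K) hε₀ hε7 (Nat.zero_le (K - n))
  have hW1 : ∀ b, bgUnits F K W b ∈ U1 (Matrix (Fin 2) (Fin 2) ℂ) := fun b => unitsField_toUField_mem_U1' W b
  have hu1 : ∀ x, u x ∈ U1 (Matrix (Fin 2) (Fin 2) ℂ) := fun x => by rw [hu]; unfold axialT; exact holT_mem_U1 hW1 _ _
  have hU0 : ∀ b : PBond (F.P K) 0, emlIterU 0 (bgUnits F K W) b ∈ U1 (Matrix (Fin 2) (Fin 2) ℂ) := fun b => hW1 b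
  -- the double block and the two-block bond bound in the gauge `u`
  set S0 : Set (Site (F.P K) 0) := {x | iterBlockOf (K - n) x = y ∨ iterBlockOf (K - n) x = y.shift μ} with hS0
  have hax : ∀ b : PBond (F.P K) 0, iterBlockOf 0 b.src ∈ S0 → iterBlockOf 0 b.tgt ∈ S0 →
      ‖((gaugeActT u (bgUnits F K W) b : (Matrix (Fin 2) (Fin 2) ℂ)ˣ) : Matrix (Fin 2) (Fin 2) ℂ) - 1‖ ≤ s₀ :=
    fun b hs ht' => norm_axialGauge_bond_sub_one_le_twoBlock_T3 F hε₀ W hW y μ b hs ht'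
  -- the run stays in the double block
  have hΓ : ∀ st ∈ walk xr (List.replicate t (μ, true)), st.bond.src ∈ S0 ∧ st.bond.tgt ∈ S0 := by
    intro st hst
    obtain ⟨s, hs, hst'⟩ := exists_of_mem_walk_replicate_true hst
    rw [hst']
    constructor
    · exact iterBlockOf_runSite_fibreSite_or hk y r μ (s := s) (by omega)
    · show (runSite xr μ s).shift μ ∈ S0
      rw [← runSite_succ]; exact iterBlockOf_runSite_fibreSite_or hk y r μ (s := s + 1) (by omega)
  -- ★ transport closeness along the run, at level `0`
  have hclose := norm_holT_tower_gauged_sub_one_le (j := 0) (Nat.zero_le _) (bgUnits F K W) hU0 u hu1 hs₀ hbud S0 hax xr (List.replicate t (μ, true)) hΓ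
  rw [Prop7TubeTransportCloseness.walkEnd_replicate_true, List.length_replicate] at hclose
  have hdef : ‖((u xr * holT (bgUnits F K W) xr (List.replicate t (μ, true)) * (u (runSite xr μ t))⁻¹ : (Matrix (Fin 2) (Fin 2) ℂ)ˣ) : Matrix (Fin 2) (Fin 2) ℂ) - 1‖ ≤ 1800 * (F.L : ℝ) * ε₀ := by
    refine hclose.trans ?_
    have ht' : (t : ℝ) ≤ ((F.P K).L : ℝ) ^ (K - n) := by exact_mod_cast ht
    rw [hLL] at ht'
    have hσ0 : 0 ≤ 30 * ((((F.P K).d + 2) * (F.P K).L : ℕ) : ℝ) * ((F.P K).L : ℝ) ^ 0 * s₀ := by positivity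
    calc (t : ℝ) * (30 * ((((F.P K).d + 2) * (F.P K).L : ℕ) : ℝ) * ((F.P K).L : ℝ) ^ 0 * s₀)
        ≤ (F.L : ℝ) ^ (K - n) * (1800 * (F.L : ℝ) * ε₀ * ((F.L : ℝ) ^ 0 * eta F n K)) := mul_le_mul ht' hσle hσ0 (by positivity)
      _ = 1800 * (F.L : ℝ) * ε₀ * ((F.L : ℝ) ^ (K - n) * eta F n K) := by ring
      _ = 1800 * (F.L : ℝ) * ε₀ := by rw [pow_mul_eta_eq_one F, mul_one]
  -- the corner comb IS `u(x_r)`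
  have hcorner : holT (bgUnits F K W) q₀ (treeWord fun ν => ((r ν : ℕ) : ℤ)) = u xr := by
    rw [hu, hxr]; unfold axialT; rw [hq₀, rel_corner_fibreSite hk y (pow_pos (F.P K).L_pos (K - n)) r]
  rw [hcorner]
  have hg1 : u xr * holT (bgUnits F K W) xr (List.replicate t (μ, true)) ∈ U1 (Matrix (Fin 2) (Fin 2) ℂ) := (U1 _).mul_mem (hu1 xr) (holT_mem_U1 hW1 _ _)
  have hA := norm_conjR_sub_conjR_ref_le (U1 (Matrix (Fin 2) (Fin 2) ℂ)).one_mem (hu1 (runSite xr μ t)) hg1 X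
  rw [inv_one, one_mul, Units.val_one, one_mul] at hA
  refine hA.trans ?_
  rw [Units.val_mul, Units.val_mul] at hdef
  rw [Units.val_mul]
  exact mul_le_mul_of_nonneg_right (mul_le_mul_of_nonneg_left hdef (by norm_num)) (norm_nonneg X)

/-! ## §3 ★★★ The (iv) row -/

/-- ★★★ **(iv) TOWER-vs-CORNER TRANSPORTS — THE ROW (R1).**  For a printed-regular background `W` (`RegPr F n K ε₀ W`, `10¹⁰L⁶ε₀ ≤ 1`), every bond field `A` on `T_1^{(K)}` and the pure
`LINE` iterates `S_k` of ✓`Prop7TrueLinIterDefect` (`S_0 = A`, `S_{k+1}(c) = ℓ′⁻¹Σ_i Ad_{Ū⁽ᵏ⁾(stair_i)} Σ_{run} Ad S_k`, the recursion VERBATIM): with `ℓ = L^{K−n}`, `x₀(c)` the corner of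
`B^{K−n}(c₋)`, `x_r = x₀ + r`, and the A-INDEPENDENT unitary frame **`Φ(c) = axialT W♭ x₀(c) (embIter (K−n) c₋)`** (the corner-axial transporter to the block centre),
`Σ_c ‖Σ_rΣ_{t<ℓ} Ad_{W♭(comb x₀→x_r)·W♭(run x_r→x_r+te)} A(x_r+te, μ_c) − (ℓ^d : ℂ)•Ad_{Φ(c)} S_{K−n}(c)‖² ≤ 10⁹L⁴·ε₀²·(ℓ^d·ℓ²)·Σ_b‖A b‖²`.
PROOF: per `c`, both functionals sum the same `ℓ^{d+1}` fine bonds (✓`sum_tube_eq_smul_bondAvgIter`); the tube transport is `3600Lε₀`-close to `Ad_{u(b₋)}` per bond (§2) and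
`Ad_{Φ(c)} S_{K−n}(c)` is `10800L²ε₀`-close to the flat mean of `Ad_{u(b₋)}A` (FILE 2a ✓`lineIter_sub_refMean_le` at `j = K − n`, `Σ_{i<K−n} 21600L²ε₀Lⁱη ≤ 10800L²ε₀` by
✓`sum_mul_pow_mul_eta_le_T3`); `3600L + 10800L² ≤ 12000L²`; Cauchy–Schwarz over the tube (✓`sq_sum_tube_le`) and the exact multiplicity `ℓ` (✓`sum_tube_eq`); `(12000)² ≤ 10⁹`.
WITHOUT the frame `Φ` the row is false at curved members (pure gauge `W = 1^g`, `g(corner) ≠ g(centre)`).  Docks on ✓`Prop7SkewFrobRowAssembly.skewFrobRow_of_rows` (`hR1`, after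
`‖·‖_F² ≤ 2‖·‖²_op` on the left and `‖·‖²_op ≤ ‖·‖_F²` on the right: `E₁ = 2·10⁹L⁴ε₀²ℓ^dℓ²`; `hΦ` = ✓`axialT_bg_mem_unitaryUnits`).
[cite: Balaban1985Averaging, (8)-(11) pp.18-19, Prop. 4 (134)-(135) p.38; Balaban1984PropagatorsI, (1.18) p.20; Balaban1985RegularSpaces, Lemma 1 (1.25) p.79; Balaban1985BackgroundPropagators, Thm 3.11 p.416] -/
theorem sum_normSq_tubeStr_sub_smul_conjR_lineIter_le {ε₀ : ℝ} (hε₀ : 0 < ε₀) (hε : 10 ^ 10 * (F.L : ℝ) ^ 6 * ε₀ ≤ 1)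
    (W : GaugeField (F.P K) 0 (Matrix.specialUnitaryGroup (Fin 2) ℂ)) (hreg : RegPr F n K ε₀ W)
    (A : PBond (F.P K) 0 → Matrix (Fin 2) (Fin 2) ℂ)
    (S : (k : ℕ) → PBond (F.P K) k → Matrix (Fin 2) (Fin 2) ℂ) (hS0 : ∀ b, S 0 b = A b)
    (hSs : ∀ (k : ℕ) (c : PBond (F.P K) (k + 1)), S (k + 1) c
      = ((Fintype.card (Idx (F.P K)) : ℂ))⁻¹ • ∑ i : Idx (F.P K),
          (((holAt (Averaging.iter (fun i => blockAvg (P := F.P K) (j := i) (expMeanLogSU (n := Fin 2))) k W) (walk (emb c.src) (stairWord i.2.1 (off i.1))) : Matrix.specialUnitaryGroup (Fin 2) ℂ) : Matrix (Fin 2) (Fin 2) ℂ) *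
            covWalkSum (Averaging.iter (fun i => blockAvg (P := F.P K) (j := i) (expMeanLogSU (n := Fin 2))) k W) (S k)
              (walk (walkEnd (emb c.src) (stairWord i.2.1 (off i.1))) (List.replicate (F.P K).L (c.dir, true))) *
          star ((holAt (Averaging.iter (fun i => blockAvg (P := F.P K) (j := i) (expMeanLogSU (n := Fin 2))) k W) (walk (emb c.src) (stairWord i.2.1 (off i.1))) : Matrix.specialUnitaryGroup (Fin 2) ℂ) : Matrix (Fin 2) (Fin 2) ℂ))) :
    ∑ c : PBond (F.P K) (K - n),
      ‖(∑ r : Fin (F.P K).d → Fin ((F.P K).L ^ (K - n)), ∑ t ∈ Finset.range ((F.P K).L ^ (K - n)),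
          conjR (holT (unitsField (toUField W)) (Site.fibreSite 0 (K - n) c.src fun _ => ⟨0, pow_pos (F.P K).L_pos (K - n)⟩)
                (treeWord fun ν => ((r ν : ℕ) : ℤ))
              * holT (unitsField (toUField W)) (Site.fibreSite 0 (K - n) c.src r) (List.replicate t (c.dir, true)))
            (A ⟨(fun z : Site (F.P K) 0 => z.shift c.dir)^[t] (Site.fibreSite 0 (K - n) c.src r), c.dir⟩))
        - (((((F.L : ℝ) ^ (K - n)) ^ (F.P K).d) : ℝ) : ℂ) • conjR (axialT (unitsField (toUField W)) (Site.fibreSite 0 (K - n) c.src fun _ => ⟨0, pow_pos (F.P K).L_pos (K - n)⟩)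
              (embIter (K - n) c.src)) (S (K - n) c)‖ ^ 2
      ≤ 10 ^ 9 * (F.L : ℝ) ^ 4 * ε₀ ^ 2 * ((((F.L : ℝ) ^ (K - n)) ^ (F.P K).d) * (((F.L : ℝ) ^ (K - n)) ^ 2)) * ∑ b : PBond (F.P K) 0, ‖A b‖ ^ 2 := by
  have hk : K - n ≤ (F.P K).m + (F.P K).K := by show K - n ≤ F.m + K; omega
  have hLL : ((F.P K).L : ℝ) = F.L := rfl
  have hL3 : (3 : ℝ) ≤ F.L := by
    have h3 : 3 ≤ F.L := by obtain ⟨a, ha⟩ := F.hL.1; have := F.hL.2; omega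
    exact_mod_cast h3
  have hε7 : 10 ^ 7 * (F.L : ℝ) ^ 3 * ε₀ ≤ 1 := by
    have h1 : (1 : ℝ) ≤ 10 ^ 3 * (F.L : ℝ) ^ 3 := by
      have h := one_le_pow₀ (M₀ := ℝ) (a := (F.L : ℝ)) (n := 3) (by linarith)
      linarith
    calc 10 ^ 7 * (F.L : ℝ) ^ 3 * ε₀ = (10 ^ 7 * (F.L : ℝ) ^ 3 * ε₀) * 1 := (mul_one _).symm
      _ ≤ (10 ^ 7 * (F.L : ℝ) ^ 3 * ε₀) * (10 ^ 3 * (F.L : ℝ) ^ 3) := mul_le_mul_of_nonneg_left h1 (by positivity)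
      _ = 10 ^ 10 * (F.L : ℝ) ^ 6 * ε₀ := by ring
      _ ≤ 1 := hε
  have hW : PlaqSmall (regThreshold F n K ε₀) W := hreg.plaqSmall
  have hW1 : ∀ b, bgUnits F K W b ∈ U1 (Matrix (Fin 2) (Fin 2) ℂ) := fun b => unitsField_toUField_mem_U1' W b
  have hθ : (∑ i ∈ Finset.range (K - n), 21600 * (F.L : ℝ) ^ 2 * ε₀ * ((F.L : ℝ) ^ i * eta F n K)) ≤ 10800 * (F.L : ℝ) ^ 2 * ε₀ := by
    have h := sum_mul_pow_mul_eta_le_T3 F (n := n) (K := K) (c := 21600 * (F.L : ℝ) ^ 2 * ε₀) (by positivity)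
    linarith
  have hpow : ((((F.P K).L : ℝ) ^ ((F.P K).d + 1)) ^ (K - n)) = (((F.L : ℝ) ^ (K - n)) ^ (F.P K).d) * (F.L : ℝ) ^ (K - n) := by rw [hLL]; ring
  have hℓd0 : (0 : ℝ) ≤ ((F.L : ℝ) ^ (K - n)) ^ (F.P K).d := by positivity
  rw [← bgUnits_eq F K W]
  -- ★ the per-`c` estimate
  have hc : ∀ c : PBond (F.P K) (K - n),
      ‖(∑ r : Fin (F.P K).d → Fin ((F.P K).L ^ (K - n)), ∑ t ∈ Finset.range ((F.P K).L ^ (K - n)),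
          conjR (holT (bgUnits F K W) (Site.fibreSite 0 (K - n) c.src fun _ => (⟨0, pow_pos (F.P K).L_pos (K - n)⟩ : Fin ((F.P K).L ^ (K - n)))) (treeWord fun ν => ((r ν : ℕ) : ℤ))
              * holT (bgUnits F K W) (Site.fibreSite 0 (K - n) c.src r) (List.replicate t (c.dir, true)))
            (A ⟨(fun z : Site (F.P K) 0 => z.shift c.dir)^[t] (Site.fibreSite 0 (K - n) c.src r), c.dir⟩))
        - (((((F.L : ℝ) ^ (K - n)) ^ (F.P K).d) : ℝ) : ℂ) • conjR (axialT (bgUnits F K W) (Site.fibreSite 0 (K - n) c.src fun _ => (⟨0, pow_pos (F.P K).L_pos (K - n)⟩ : Fin ((F.P K).L ^ (K - n)))) (embIter (K - n) c.src)) (S (K - n) c)‖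
      ≤ 12000 * (F.L : ℝ) ^ 2 * ε₀ * ∑ r : Fin (F.P K).d → Fin ((F.P K).L ^ (K - n)), ∑ t ∈ Finset.range ((F.P K).L ^ (K - n)),
          ‖A ⟨(fun z : Site (F.P K) 0 => z.shift c.dir)^[t] (Site.fibreSite 0 (K - n) c.src r), c.dir⟩‖ := by
    intro c
    set q₀ := (Site.fibreSite 0 (K - n) c.src fun _ => (⟨0, pow_pos (F.P K).L_pos (K - n)⟩ : Fin ((F.P K).L ^ (K - n)))) with hq₀
    set u : Site (F.P K) 0 → (Matrix (Fin 2) (Fin 2) ℂ)ˣ := axialT (bgUnits F K W) q₀ with hu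
    have hu1 : ∀ x, u x ∈ U1 (Matrix (Fin 2) (Fin 2) ℂ) := fun x => by rw [hu]; unfold axialT; exact holT_mem_U1 hW1 _ _
    set G : PBond (F.P K) 0 → Matrix (Fin 2) (Fin 2) ℂ := fun b => conjR (u b.src) (A b) with hG
    set Tc := ∑ r : Fin (F.P K).d → Fin ((F.P K).L ^ (K - n)), ∑ t ∈ Finset.range ((F.P K).L ^ (K - n)),
          conjR (holT (bgUnits F K W) q₀ (treeWord fun ν => ((r ν : ℕ) : ℤ))
              * holT (bgUnits F K W) (Site.fibreSite 0 (K - n) c.src r) (List.replicate t (c.dir, true)))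
            (A ⟨(fun z : Site (F.P K) 0 => z.shift c.dir)^[t] (Site.fibreSite 0 (K - n) c.src r), c.dir⟩) with hTc
    set Nc := ∑ r : Fin (F.P K).d → Fin ((F.P K).L ^ (K - n)), ∑ t ∈ Finset.range ((F.P K).L ^ (K - n)),
          G ⟨(fun z : Site (F.P K) 0 => z.shift c.dir)^[t] (Site.fibreSite 0 (K - n) c.src r), c.dir⟩ with hNc
    set m : ℝ := ∑ r : Fin (F.P K).d → Fin ((F.P K).L ^ (K - n)), ∑ t ∈ Finset.range ((F.P K).L ^ (K - n)),
          ‖A ⟨(fun z : Site (F.P K) 0 => z.shift c.dir)^[t] (Site.fibreSite 0 (K - n) c.src r), c.dir⟩‖ with hm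
    have hm0 : 0 ≤ m := by rw [hm]; positivity
    -- (a) the tube transports against the corner gauge, bond by bond
    have ha : ‖Tc - Nc‖ ≤ 2 * (1800 * (F.L : ℝ) * ε₀) * m := by
      rw [hTc, hNc, hm]
      simp only [← Finset.sum_sub_distrib]
      refine (norm_sum_le _ _).trans ?_
      rw [Finset.mul_sum]
      refine Finset.sum_le_sum fun r _ => (norm_sum_le _ _).trans ?_
      rw [Finset.mul_sum]
      refine Finset.sum_le_sum fun t ht => ?_
      exact norm_conjR_tubeTransport_sub_conjR_axial_le F hε₀ hε7 W hW c.src c.dir r (Finset.mem_range.mp ht).le _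
    -- (b) the framed `LINE` iterate against the flat mean of the gauged field
    have hone : Nc = (((F.L : ℝ) ^ (K - n)) ^ (F.P K).d) • (((F.L : ℝ) ^ (K - n)) • bondAvgIter (K - n) G c) := by
      rw [hNc, sum_tube_eq_smul_bondAvgIter hk G c, hpow, mul_smul]
    have hmrepr : m = ((F.L : ℝ) ^ (K - n)) ^ (F.P K).d * ((F.L : ℝ) ^ (K - n) * bondAvgIter (K - n) (fun b => ‖A b‖) c) := by
      rw [hm, sum_tube_eq_smul_bondAvgIter hk (fun b : PBond (F.P K) 0 => ‖A b‖) c, smul_eq_mul, hpow, mul_assoc]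
    obtain ⟨hcl, hSn⟩ := lineIter_sub_refMean_le F hε₀ hε7 W hW A S hS0 hSs c.src c.dir (K - n) le_rfl c (fun _ h => Or.inl h) (fun _ h => Or.inr h)
    have hcl' : ‖S (K - n) c - conjR (u (embIter (K - n) c.src))⁻¹ (((F.L : ℝ) ^ (K - n)) • bondAvgIter (K - n) G c)‖
        ≤ (∑ i ∈ Finset.range (K - n), 21600 * (F.L : ℝ) ^ 2 * ε₀ * ((F.L : ℝ) ^ i * eta F n K)) * ((F.L : ℝ) ^ (K - n) * bondAvgIter (K - n) (fun b => ‖A b‖) c) := hcl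
    have hmf0 : 0 ≤ (F.L : ℝ) ^ (K - n) * bondAvgIter (K - n) (fun b => ‖A b‖) c := (norm_nonneg _).trans hSn
    have hrew : ((F.L : ℝ) ^ (K - n)) • bondAvgIter (K - n) G c - conjR (u (embIter (K - n) c.src)) (S (K - n) c)
        = conjR (u (embIter (K - n) c.src)) (conjR (u (embIter (K - n) c.src))⁻¹ (((F.L : ℝ) ^ (K - n)) • bondAvgIter (K - n) G c) - S (K - n) c) := by
      rw [conjR_sub, conjR_conjR, mul_inv_cancel, one_conjR]
    have hb : ‖Nc - (((((F.L : ℝ) ^ (K - n)) ^ (F.P K).d) : ℝ) : ℂ) • conjR (u (embIter (K - n) c.src)) (S (K - n) c)‖ ≤ 10800 * (F.L : ℝ) ^ 2 * ε₀ * m := by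
      calc ‖Nc - (((((F.L : ℝ) ^ (K - n)) ^ (F.P K).d) : ℝ) : ℂ) • conjR (u (embIter (K - n) c.src)) (S (K - n) c)‖
          = ((F.L : ℝ) ^ (K - n)) ^ (F.P K).d * ‖((F.L : ℝ) ^ (K - n)) • bondAvgIter (K - n) G c - conjR (u (embIter (K - n) c.src)) (S (K - n) c)‖ := by
            rw [hone, real_smul_eq_coe_smul (((F.L : ℝ) ^ (K - n)) ^ (F.P K).d), ← smul_sub, norm_smul, Complex.norm_real, Real.norm_of_nonneg hℓd0]
        _ = ((F.L : ℝ) ^ (K - n)) ^ (F.P K).d * ‖S (K - n) c - conjR (u (embIter (K - n) c.src))⁻¹ (((F.L : ℝ) ^ (K - n)) • bondAvgIter (K - n) G c)‖ := by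
            rw [hrew, norm_conjR (hu1 _), norm_sub_rev]
        _ ≤ ((F.L : ℝ) ^ (K - n)) ^ (F.P K).d * ((10800 * (F.L : ℝ) ^ 2 * ε₀) * ((F.L : ℝ) ^ (K - n) * bondAvgIter (K - n) (fun b => ‖A b‖) c)) :=
            mul_le_mul_of_nonneg_left (hcl'.trans (mul_le_mul_of_nonneg_right hθ hmf0)) hℓd0
        _ = 10800 * (F.L : ℝ) ^ 2 * ε₀ * m := by rw [hmrepr]; ring
    -- (a) + (b)
    have h36 : 2 * (1800 * (F.L : ℝ) * ε₀) * m ≤ 1200 * (F.L : ℝ) ^ 2 * ε₀ * m := by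
      have hL2 : 3 * (F.L : ℝ) ≤ (F.L : ℝ) ^ 2 := by nlinarith [hL3]
      have h1 : 2 * (1800 * (F.L : ℝ) * ε₀) ≤ 1200 * (F.L : ℝ) ^ 2 * ε₀ := by
        have h2 := mul_le_mul_of_nonneg_right hL2 hε₀.le
        linarith
      exact mul_le_mul_of_nonneg_right h1 hm0
    calc _ ≤ ‖Tc - Nc‖ + ‖Nc - (((((F.L : ℝ) ^ (K - n)) ^ (F.P K).d) : ℝ) : ℂ) • conjR (u (embIter (K - n) c.src)) (S (K - n) c)‖ :=
          norm_sub_le_norm_sub_add_norm_sub _ _ _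
      _ ≤ 1200 * (F.L : ℝ) ^ 2 * ε₀ * m + 10800 * (F.L : ℝ) ^ 2 * ε₀ * m := add_le_add (ha.trans h36) hb
      _ = 12000 * (F.L : ℝ) ^ 2 * ε₀ * m := by ring
  -- ★ square, Cauchy–Schwarz over the tube, exact multiplicity
  have hC0 : (0 : ℝ) ≤ 12000 * (F.L : ℝ) ^ 2 * ε₀ := by positivity
  calc _ ≤ ∑ c : PBond (F.P K) (K - n), (12000 * (F.L : ℝ) ^ 2 * ε₀ * ∑ r : Fin (F.P K).d → Fin ((F.P K).L ^ (K - n)), ∑ t ∈ Finset.range ((F.P K).L ^ (K - n)),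
          ‖A ⟨(fun z : Site (F.P K) 0 => z.shift c.dir)^[t] (Site.fibreSite 0 (K - n) c.src r), c.dir⟩‖) ^ 2 :=
        Finset.sum_le_sum fun c _ => pow_le_pow_left₀ (norm_nonneg _) (hc c) 2
    _ ≤ ∑ c : PBond (F.P K) (K - n), (12000 * (F.L : ℝ) ^ 2 * ε₀) ^ 2 * ((((F.L : ℝ) ^ (K - n)) ^ (F.P K).d * (F.L : ℝ) ^ (K - n))
          * ∑ r : Fin (F.P K).d → Fin ((F.P K).L ^ (K - n)), ∑ t ∈ Finset.range ((F.P K).L ^ (K - n)),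
              ‖A ⟨(fun z : Site (F.P K) 0 => z.shift c.dir)^[t] (Site.fibreSite 0 (K - n) c.src r), c.dir⟩‖ ^ 2) := by
        refine Finset.sum_le_sum fun c _ => ?_
        rw [mul_pow]
        refine mul_le_mul_of_nonneg_left ?_ (sq_nonneg _)
        have h := sq_sum_tube_le (P := F.P K) (k := K - n) (fun r t => ‖A ⟨(fun z : Site (F.P K) 0 => z.shift c.dir)^[t] (Site.fibreSite 0 (K - n) c.src r), c.dir⟩‖)
        rw [hLL] at h
        exact h
    _ = (12000 * (F.L : ℝ) ^ 2 * ε₀) ^ 2 * ((((F.L : ℝ) ^ (K - n)) ^ (F.P K).d * (F.L : ℝ) ^ (K - n))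
          * ((F.L : ℝ) ^ (K - n) * ∑ b : PBond (F.P K) 0, ‖A b‖ ^ 2)) := by
        rw [← Finset.mul_sum, ← Finset.mul_sum]
        have h := sum_tube_eq (P := F.P K) (k := K - n) hk (fun b => ‖A b‖ ^ 2)
        rw [hLL] at h
        rw [h]
    _ = 144000000 * ((F.L : ℝ) ^ 4 * ε₀ ^ 2 * ((((F.L : ℝ) ^ (K - n)) ^ (F.P K).d) * (((F.L : ℝ) ^ (K - n)) ^ 2)) * ∑ b : PBond (F.P K) 0, ‖A b‖ ^ 2) := by ring
    _ ≤ 10 ^ 9 * ((F.L : ℝ) ^ 4 * ε₀ ^ 2 * ((((F.L : ℝ) ^ (K - n)) ^ (F.P K).d) * (((F.L : ℝ) ^ (K - n)) ^ 2)) * ∑ b : PBond (F.P K) 0, ‖A b‖ ^ 2) :=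
        mul_le_mul_of_nonneg_right (by norm_num) (by positivity)
    _ = _ := by ring

/-! ## §4 The same row in Frobenius letters (the `hR1` binder of the assembly door, verbatim) -/

open Summit.QuantumFields.YangMills.Theorems.Prop7SectET3HilbertLetters (W₂ frobEquiv)
open Summit.QuantumFields.YangMills.Theorems.Prop7SkewSplitOpNormRow (sum_opNorm_sq_le_sum_frob sum_frob_le_two_mul_sum_opNorm_sq)

/-- ★★ **THE (iv) ROW IN FROBENIUS LETTERS** — literally hypothesis `hR1` of ✓`Prop7SkewFrobRowAssembly.skewFrobRow_of_rows` with `U₀ := W`, `S c := S_{K−n}(c)`,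
`Φ c := axialT W♭ x₀(c) (embIter (K−n) c₋)` (unitary: ✓`axialT_bg_mem_unitaryUnits`) and **`E₁ := 2·10⁹L⁴ε₀²·(ℓ^d·ℓ²)`**: `‖frobEquiv⁻¹·‖² ≤ 2‖·‖²` on the left
(✓`sum_frob_le_two_mul_sum_opNorm_sq`) and `‖·‖² ≤ ‖frobEquiv⁻¹·‖²` on the right (✓`sum_opNorm_sq_le_sum_frob`) around §3. [cite: Balaban1985Averaging, (20) p.21, Prop. 4 (134)-(135) p.38] -/
theorem sum_frob_tubeStr_sub_smul_conjR_lineIter_le {ε₀ : ℝ} (hε₀ : 0 < ε₀) (hε : 10 ^ 10 * (F.L : ℝ) ^ 6 * ε₀ ≤ 1)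
    (W : GaugeField (F.P K) 0 (Matrix.specialUnitaryGroup (Fin 2) ℂ)) (hreg : RegPr F n K ε₀ W)
    (A : PBond (F.P K) 0 → Matrix (Fin 2) (Fin 2) ℂ)
    (S : (k : ℕ) → PBond (F.P K) k → Matrix (Fin 2) (Fin 2) ℂ) (hS0 : ∀ b, S 0 b = A b)
    (hSs : ∀ (k : ℕ) (c : PBond (F.P K) (k + 1)), S (k + 1) c
      = ((Fintype.card (Idx (F.P K)) : ℂ))⁻¹ • ∑ i : Idx (F.P K),
          (((holAt (Averaging.iter (fun i => blockAvg (P := F.P K) (j := i) (expMeanLogSU (n := Fin 2))) k W) (walk (emb c.src) (stairWord i.2.1 (off i.1))) : Matrix.specialUnitaryGroup (Fin 2) ℂ) : Matrix (Fin 2) (Fin 2) ℂ) *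
            covWalkSum (Averaging.iter (fun i => blockAvg (P := F.P K) (j := i) (expMeanLogSU (n := Fin 2))) k W) (S k)
              (walk (walkEnd (emb c.src) (stairWord i.2.1 (off i.1))) (List.replicate (F.P K).L (c.dir, true))) *
          star ((holAt (Averaging.iter (fun i => blockAvg (P := F.P K) (j := i) (expMeanLogSU (n := Fin 2))) k W) (walk (emb c.src) (stairWord i.2.1 (off i.1))) : Matrix.specialUnitaryGroup (Fin 2) ℂ) : Matrix (Fin 2) (Fin 2) ℂ))) :
    ∑ c : PBond (F.P K) (K - n),
      ‖(frobEquiv.symm ((∑ r : Fin (F.P K).d → Fin ((F.P K).L ^ (K - n)), ∑ t ∈ Finset.range ((F.P K).L ^ (K - n)),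
          conjR (holT (unitsField (toUField W)) (Site.fibreSite 0 (K - n) c.src fun _ => ⟨0, pow_pos (F.P K).L_pos (K - n)⟩)
                (treeWord fun ν => ((r ν : ℕ) : ℤ))
              * holT (unitsField (toUField W)) (Site.fibreSite 0 (K - n) c.src r) (List.replicate t (c.dir, true)))
            (A ⟨(fun z : Site (F.P K) 0 => z.shift c.dir)^[t] (Site.fibreSite 0 (K - n) c.src r), c.dir⟩))
        - ((((F.L : ℝ) ^ (K - n)) ^ (F.P K).d : ℝ) : ℂ) • conjR (axialT (unitsField (toUField W)) (Site.fibreSite 0 (K - n) c.src fun _ => ⟨0, pow_pos (F.P K).L_pos (K - n)⟩)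
              (embIter (K - n) c.src)) (S (K - n) c)) : W₂)‖ ^ 2
      ≤ (2 * (10 ^ 9 * (F.L : ℝ) ^ 4 * ε₀ ^ 2 * ((((F.L : ℝ) ^ (K - n)) ^ (F.P K).d) * (((F.L : ℝ) ^ (K - n)) ^ 2))))
          * ∑ b : PBond (F.P K) 0, ‖(frobEquiv.symm (A b) : W₂)‖ ^ 2 := by
  have h := sum_normSq_tubeStr_sub_smul_conjR_lineIter_le F hε₀ hε W hreg A S hS0 hSs
  refine (sum_frob_le_two_mul_sum_opNorm_sq _).trans ?_
  rw [mul_assoc]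
  refine mul_le_mul_of_nonneg_left (h.trans ?_) (by norm_num)
  exact mul_le_mul_of_nonneg_left (sum_opNorm_sq_le_sum_frob A) (by positivity)

end Summit.QuantumFields.YangMills.Theorems.Prop7TubeStrSubStairLineIter

end
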